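import Literature.NumberTheory.LFunctions.KloostermanFractionsOptimiseL
import Literature.NumberTheory.LFunctions.KloostermanFractionsAmplifiedForm
import HarnessLib

/-!
# Bilinear forms with Kloosterman fractions: from (5.1) for all admissible `L` to (5.2)

Topic `NumberTheory/LFunctions`.  S. Bettin, V. Chandee, *Trilinear forms with Kloosterman
fractions*, Adv. Math. 328 (2018), §5.  The amplification method bounds the second moment
`𝓒_b(M, N'; γ)` (here with `m ∼ M`, `∑_{M<m≤2M,(m,b)=1} |kfInner k b N' γ m|²`) for every admissible
length `L` of the amplifier by (2.2)+(5.1); the source then chooses `L` ((5.2)).  This file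
PROVES that passage as a stand-alone implication (`BC_Cb_bound_of_L_bound`): a bound of the shape
(5.1) valid for all real `L ≥ max(1, Lmin)` with an admissibility threshold `Lmin(b, M, N', k)` of
logarithmic size implies the (5.2)-shape hypothesis `H52` of `BC_C1_bound_of_Cb_bound`
(`KloostermanFractionsFromCb.lean`) — using `BC_optimise_L` (`KloostermanFractionsOptimiseL.lean`)
with `X = max(1, Lmin)` and absorbing `X^{3/2} ≪ (bMN'(1+|k|))^{ε/2}` (`DFI_log_threshold_le`).

## References

* S. Bettin, V. Chandee, Adv. Math. 328 (2018) 1234–1262 (arXiv:1502.00769), §5 ((2.2), (5.1), (5.2)).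
  [BettinChandee2018]
-/

noncomputable section

open Finset Real

namespace Literature.NumberTheory.LFunctions

/-- `(1 + C(1 + log(1+x)))^{3/2} ≤ C' x^{δ}`-type absorption: for `x ≥ 1/2`, `δ > 0`, `C ≥ 0`,
`1 + C (1 + log (1 + x)) ≤ (1 + C (1 + log 3 + 2/δ)) x^{δ}`… we use the cruder
`1 + C(1 + log(1+x)) ≤ (1 + 2C + C/δ) (2x)^δ`. [folklore] -/
theorem DFI_log_threshold_le {x δ C : ℝ} (hx : 1 / 2 ≤ x) (hδ : 0 < δ) (hC : 0 ≤ C) :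
    1 + C * (1 + Real.log (1 + x)) ≤ (1 + 2 * C + C / δ) * (2 * x) ^ δ := by
  have h2x : 1 ≤ 2 * x := by linarith
  have h1 : Real.log (1 + x) ≤ Real.log (2 * x) + 1 := by
    have : Real.log (1 + x) ≤ Real.log (2 * x + 1) := Real.log_le_log (by linarith) (by linarith)
    have h3 : Real.log (2 * x + 1) ≤ Real.log (2 * x) + 1 := by
      -- `log(y + 1) ≤ log y + 1` for `y ≥ 1`: `y + 1 ≤ e·y`
      have hy : (0 : ℝ) < 2 * x := by linarith
      have h4 : 2 * x + 1 ≤ Real.exp 1 * (2 * x) := by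
        have := Real.add_one_le_exp (1 : ℝ)
        nlinarith
      calc Real.log (2 * x + 1) ≤ Real.log (Real.exp 1 * (2 * x)) := Real.log_le_log (by linarith) h4
        _ = Real.log (2 * x) + 1 := by rw [Real.log_mul (Real.exp_pos 1).ne' hy.ne', Real.log_exp]; ring
    linarith
  have h5 : Real.log (2 * x) ≤ (2 * x) ^ δ / δ := Real.log_le_rpow_div (by linarith) hδ
  have h6 : (1 : ℝ) ≤ (2 * x) ^ δ := Real.one_le_rpow h2x hδ.le
  have h7 : 0 ≤ C * (2 * x) ^ δ := by positivity
  have h8 : 1 + Real.log (1 + x) ≤ 2 + (2 * x) ^ δ / δ := by linarith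
  calc 1 + C * (1 + Real.log (1 + x)) ≤ 1 + C * (2 + (2 * x) ^ δ / δ) := by
        have := mul_le_mul_of_nonneg_left h8 hC
        linarith
    _ = 1 + 2 * C + C / δ * (2 * x) ^ δ := by ring
    _ ≤ (2 * x) ^ δ + 2 * C * (2 * x) ^ δ + C / δ * (2 * x) ^ δ := by
        have : 0 ≤ C / δ * (2 * x) ^ δ := by positivity
        nlinarith
    _ = (1 + 2 * C + C / δ) * (2 * x) ^ δ := by ring

/-- **From (5.1) for all admissible `L` to (5.2)** (Bettin–Chandee §5, `A = 1`, `ϑ = k`,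
second moments with `m ∼ M` written with the tree's `kfInner`).  Suppose that for every `ε > 0`
there is `K` such that for every squarefull `b ≥ 1`, `M, N' ≥ 1/2` with `b ≤ N'`, `k ≠ 0` with
`(b,k) = 1`, `γ` on squarefree `N' < n ≤ 2N'` coprime to `bk`, and EVERY real `L` at least an
admissibility threshold `Lmin(b,M,N',k)` of logarithmic size (`≤ C(1 + log(1 + bMN'(1+|k|)))`;
the source's "`L ≥ 2 log(bϑM)`", and the tree's `DFI_card_primes_Ioc_ge` threshold),
`𝓒_b ≤ K‖γ‖²(bMN'(1+|k|))^ε(1+|k|/(bN'M))^{1/2}(M(bN')^{1/2}L^{-1/2} + M²/(bLN') + M²/L + b^{3/4}M^{1/2}N'^{5/4}L^{-1/2} + b^{1/2}L^{3/2}N'^{7/4} + b^{1/2}MN'/L)`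
((5.1) with (2.2) applied).  Then (5.2) holds in the form of the hypothesis of
`BC_C1_bound_of_Cb_bound` (`KloostermanFractionsFromCb.lean`): choose
`L = M^{4/5}b^{-3/5}N'^{-11/10} + M^{4/5}b^{-1/5}N'^{-7/10} + M^{2/5}N'^{-3/10} + max(1, Lmin)`
(`BC_optimise_L`); the factor `max(1, Lmin)^{3/2}` is `≪ (bMN'(1+|k|))^{ε}` (`DFI_log_threshold_le`).
[cite: BettinChandee2018, §5] -/
theorem BC_Cb_bound_of_L_bound (Lmin : ℕ → ℝ → ℝ → ℤ → ℝ)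
    (hLmin : ∃ C : ℝ, 0 ≤ C ∧ ∀ (b : ℕ) (M N' : ℝ) (k : ℤ), 0 < b → 1 / 2 ≤ M → 1 / 2 ≤ N' →
      Lmin b M N' k ≤ C * (1 + Real.log (1 + (b : ℝ) * M * N' * (1 + |(k : ℝ)|))))
    (h51 : ∀ ε : ℝ, 0 < ε → ∃ K : ℝ, 0 < K ∧ ∀ (b : ℕ), 0 < b → (∀ p ∈ b.primeFactors, p ^ 2 ∣ b) →
      ∀ (M N' : ℝ), 1 / 2 ≤ M → 1 / 2 ≤ N' → (b : ℝ) ≤ N' → ∀ (k : ℤ), k ≠ 0 → b.Coprime k.natAbs →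
      ∀ (γ : ℕ → ℂ),
        (∀ n : ℕ, γ n ≠ 0 → N' < n ∧ (n : ℝ) ≤ 2 * N') →
        (∀ n : ℕ, γ n ≠ 0 → Squarefree n ∧ n.Coprime b ∧ n.Coprime k.natAbs) →
        ∀ L : ℝ, Lmin b M N' k ≤ L → 1 ≤ L →
        ∑ m ∈ (Ioc ⌊M⌋₊ ⌊2 * M⌋₊).filter (fun m => m.Coprime b), ‖kfInner k b N' γ m‖ ^ 2 ≤
          K * (∑ n ∈ Icc 1 ⌊2 * N'⌋₊, ‖γ n‖ ^ 2) *
          ((b : ℝ) * M * N' * (1 + |(k : ℝ)|)) ^ ε * (1 + |(k : ℝ)| / ((b : ℝ) * N' * M)) ^ (1 / 2 : ℝ) *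
          (M * ((b : ℝ) * N') ^ (1 / 2 : ℝ) * L ^ (-(1 / 2) : ℝ) + M ^ 2 / ((b : ℝ) * L * N') + M ^ 2 / L +
            (b : ℝ) ^ (3 / 4 : ℝ) * M ^ (1 / 2 : ℝ) * N' ^ (5 / 4 : ℝ) * L ^ (-(1 / 2) : ℝ) +
            (b : ℝ) ^ (1 / 2 : ℝ) * L ^ (3 / 2 : ℝ) * N' ^ (7 / 4 : ℝ) + (b : ℝ) ^ (1 / 2 : ℝ) * M * N' / L)) :
    ∀ ε : ℝ, 0 < ε → ∃ K : ℝ, 0 < K ∧ ∀ (b : ℕ), 0 < b → (∀ p ∈ b.primeFactors, p ^ 2 ∣ b) →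
      ∀ (M N' : ℝ), 1 / 2 ≤ M → 1 / 2 ≤ N' → (b : ℝ) ≤ N' → ∀ (k : ℤ), k ≠ 0 → b.Coprime k.natAbs →
      ∀ (γ : ℕ → ℂ),
        (∀ n : ℕ, γ n ≠ 0 → N' < n ∧ (n : ℝ) ≤ 2 * N') →
        (∀ n : ℕ, γ n ≠ 0 → Squarefree n ∧ n.Coprime b ∧ n.Coprime k.natAbs) →
        ∑ m ∈ (Ioc ⌊M⌋₊ ⌊2 * M⌋₊).filter (fun m => m.Coprime b), ‖kfInner k b N' γ m‖ ^ 2 ≤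
          K * (∑ n ∈ Icc 1 ⌊2 * N'⌋₊, ‖γ n‖ ^ 2) *
          ((b : ℝ) * M * N' * (1 + |(k : ℝ)|)) ^ ε * (1 + |(k : ℝ)| / ((b : ℝ) * N' * M)) ^ (1 / 2 : ℝ) *
          (M * ((b : ℝ) * N') ^ (1 / 2 : ℝ) + (b : ℝ) ^ (3 / 4 : ℝ) * M ^ (1 / 2 : ℝ) * N' ^ (5 / 4 : ℝ) +
            M ^ (6 / 5 : ℝ) * N' ^ (1 / 10 : ℝ) * (b : ℝ) ^ (-(2 / 5) : ℝ) +
            (b : ℝ) ^ (1 / 5 : ℝ) * M ^ (6 / 5 : ℝ) * N' ^ (7 / 10 : ℝ) +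
            (b : ℝ) ^ (1 / 2 : ℝ) * M ^ (3 / 5 : ℝ) * N' ^ (13 / 10 : ℝ) + (b : ℝ) ^ (1 / 2 : ℝ) * N' ^ (7 / 4 : ℝ)) := by
  intro ε hε
  obtain ⟨C, hC0, hC⟩ := hLmin
  obtain ⟨K, hK, hB⟩ := h51 (ε / 2) (by positivity)
  -- `X^{3/2} ≤ D · x^{ε/2}` with `X = max 1 Lmin`, `x = bMN'(1+|k|)`; here `δ = ε/3`
  set D : ℝ := ((1 + 2 * C + C / (ε / 3)) * (2 : ℝ) ^ (ε / 3)) ^ (3 / 2 : ℝ) with hD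
  have hD0 : 0 < D := by positivity
  refine ⟨9 * D * K, by positivity, ?_⟩
  intro b hb hbfull M N' hM hN' hbN k hk hbk γ hγ hγ2
  have hM0 : 0 < M := by linarith
  have hN0 : 0 < N' := by linarith
  have hbr : (0 : ℝ) < b := by exact_mod_cast hb
  set x : ℝ := (b : ℝ) * M * N' * (1 + |(k : ℝ)|) with hx
  have hx0 : 0 < x := by positivity
  have hx12 : 1 / 2 ≤ x := by
    have hb1 : (1 : ℝ) ≤ b := by exact_mod_cast hb
    have hk2 : (2 : ℝ) ≤ 1 + |(k : ℝ)| := by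
      have : (1 : ℝ) ≤ |(k : ℝ)| := by rw [← Int.cast_abs]; exact_mod_cast Int.one_le_abs hk
      linarith
    have : (1 : ℝ) * (1 / 2) * (1 / 2) * 2 ≤ (b : ℝ) * M * N' * (1 + |(k : ℝ)|) := by
      gcongr
    rw [hx]; linarith
  -- the admissible `X` and `L`
  set X : ℝ := max 1 (Lmin b M N' k) with hX
  have hX1 : 1 ≤ X := le_max_left _ _
  have hXL : Lmin b M N' k ≤ X := le_max_right _ _
  set L : ℝ := M ^ (4 / 5 : ℝ) * (b : ℝ) ^ (-(3 / 5) : ℝ) * N' ^ (-(11 / 10) : ℝ) +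
    M ^ (4 / 5 : ℝ) * (b : ℝ) ^ (-(1 / 5) : ℝ) * N' ^ (-(7 / 10) : ℝ) + M ^ (2 / 5 : ℝ) * N' ^ (-(3 / 10) : ℝ) + X
    with hL
  have hpos1 : 0 < M ^ (4 / 5 : ℝ) * (b : ℝ) ^ (-(3 / 5) : ℝ) * N' ^ (-(11 / 10) : ℝ) := by positivity
  have hpos2 : 0 < M ^ (4 / 5 : ℝ) * (b : ℝ) ^ (-(1 / 5) : ℝ) * N' ^ (-(7 / 10) : ℝ) := by positivity
  have hpos3 : 0 < M ^ (2 / 5 : ℝ) * N' ^ (-(3 / 10) : ℝ) := by positivity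
  have hLX : X ≤ L := by rw [hL]; linarith
  have hL1 : 1 ≤ L := hX1.trans hLX
  have hLmin : Lmin b M N' k ≤ L := hXL.trans hLX
  have h := hB b hb hbfull M N' hM hN' hbN k hk hbk γ hγ hγ2 L hLmin hL1
  have hopt := BC_optimise_L (M := M) (N := N') (b := (b : ℝ)) hM0 hN0 hbr hX1 hL
  -- `X^{3/2} ≤ D x^{ε/2}`
  have hX32 : X ^ (3 / 2 : ℝ) ≤ D * x ^ (ε / 2) := by
    have h1 : X ≤ 1 + C * (1 + Real.log (1 + x)) := by
      refine max_le ?_ ?_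
      · have : 0 ≤ C * (1 + Real.log (1 + x)) := by
          have : 0 ≤ Real.log (1 + x) := Real.log_nonneg (by linarith)
          positivity
        linarith
      · have := hC b M N' k hb hM hN'
        rw [← hx] at this
        have h0 : (0 : ℝ) ≤ 1 := zero_le_one
        linarith
    have h2 := DFI_log_threshold_le hx12 (show (0 : ℝ) < ε / 3 by positivity) hC0
    have h3 : X ≤ (1 + 2 * C + C / (ε / 3)) * (2 * x) ^ (ε / 3) := h1.trans h2
    have h4 : X ^ (3 / 2 : ℝ) ≤ ((1 + 2 * C + C / (ε / 3)) * (2 * x) ^ (ε / 3)) ^ (3 / 2 : ℝ) :=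
      Real.rpow_le_rpow (by linarith) h3 (by norm_num)
    have h5 : ((1 + 2 * C + C / (ε / 3)) * (2 * x) ^ (ε / 3)) ^ (3 / 2 : ℝ) = D * x ^ (ε / 2) := by
      rw [Real.mul_rpow (by norm_num) hx0.le, ← mul_assoc, Real.mul_rpow (by positivity) (by positivity),
        ← Real.rpow_mul hx0.le, show ε / 3 * (3 / 2 : ℝ) = ε / 2 by ring, hD]
    rw [← h5]; exact h4
  -- assemble
  set nγ : ℝ := ∑ n ∈ Icc 1 ⌊2 * N'⌋₊, ‖γ n‖ ^ 2 with hnγ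
  have hnγ0 : 0 ≤ nγ := Finset.sum_nonneg fun _ _ => sq_nonneg _
  set W : ℝ := (1 + |(k : ℝ)| / ((b : ℝ) * N' * M)) ^ (1 / 2 : ℝ) with hW
  set T52 : ℝ := M * ((b : ℝ) * N') ^ (1 / 2 : ℝ) + (b : ℝ) ^ (3 / 4 : ℝ) * M ^ (1 / 2 : ℝ) * N' ^ (5 / 4 : ℝ) +
    M ^ (6 / 5 : ℝ) * N' ^ (1 / 10 : ℝ) * (b : ℝ) ^ (-(2 / 5) : ℝ) +
    (b : ℝ) ^ (1 / 5 : ℝ) * M ^ (6 / 5 : ℝ) * N' ^ (7 / 10 : ℝ) +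
    (b : ℝ) ^ (1 / 2 : ℝ) * M ^ (3 / 5 : ℝ) * N' ^ (13 / 10 : ℝ) + (b : ℝ) ^ (1 / 2 : ℝ) * N' ^ (7 / 4 : ℝ) with hT52
  have hT520 : 0 ≤ T52 := by positivity
  have hxε : x ^ (ε / 2) * x ^ (ε / 2) = x ^ ε := by rw [← Real.rpow_add hx0]; ring_nf
  calc _ ≤ K * nγ * x ^ (ε / 2) * W *
        (M * ((b : ℝ) * N') ^ (1 / 2 : ℝ) * L ^ (-(1 / 2) : ℝ) + M ^ 2 / ((b : ℝ) * L * N') + M ^ 2 / L +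
          (b : ℝ) ^ (3 / 4 : ℝ) * M ^ (1 / 2 : ℝ) * N' ^ (5 / 4 : ℝ) * L ^ (-(1 / 2) : ℝ) +
          (b : ℝ) ^ (1 / 2 : ℝ) * L ^ (3 / 2 : ℝ) * N' ^ (7 / 4 : ℝ) + (b : ℝ) ^ (1 / 2 : ℝ) * M * N' / L) := h
    _ ≤ K * nγ * x ^ (ε / 2) * W * (9 * X ^ (3 / 2 : ℝ) * T52) := by gcongr
    _ ≤ K * nγ * x ^ (ε / 2) * W * (9 * (D * x ^ (ε / 2)) * T52) := by gcongr
    _ = 9 * D * K * nγ * (x ^ (ε / 2) * x ^ (ε / 2)) * W * T52 := by ring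
    _ = 9 * D * K * nγ * x ^ ε * W * T52 := by rw [hxε]

end Literature.NumberTheory.LFunctions

end
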